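import Literature.Geometry.Symplectic.SymplecticDivergenceIntegral
import Literature.Geometry.GaugeTheory.SpincStructureDiracAdjoint
import Literature.Geometry.GaugeTheory.SpincStructureDiracField
import Literature.Geometry.Symplectic.TaubesFamilyLTwoBounds
import Literature.Geometry.GaugeTheory.SpincStructureDivergence
import HarnessLib

/-!
# `∫⟨φ, ∇_A^*∇_Aψ⟩ = ∫⟨∇_Aφ, ∇_Aψ⟩` and `∫⟨φ, D_Aψ⟩ = ∫⟨D_Aφ, ψ⟩` on a closed symplectic `4`-manifold

Topic `Literature/Geometry/Symplectic`; the formal self-adjointness of the connection Laplacian and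
of the Dirac operator of `𝔰_J`, integrated against the symplectic volume `s ∧ s` — the integrations
by parts invoked throughout Taubes 1994, §§2–3 ("take the inner product of both sides with `β` and
integrate the result over `X`. After an integration by parts ..."): for a unitary connection `A` on
`det P̃` and smooth spinor fields `ψ`, `φ` of `𝔰_J` on the closed symplectic `4`-manifold `(N, s, J)`,

  `∫_N (Σ_k Re⟨∇̃_{e_k}φ, ∇̃_{e_k}ψ⟩ - Re⟨φ, ∇_A^*∇_Aψ⟩)(s ∧ s) = 0`,
  `∫_N (Re⟨φ, D_Aψ⟩ - Re⟨D_Aφ, ψ⟩)(s ∧ s) = 0`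

(`integral_re_covDeriv_pairing_sub_re_laplacian_eq_zero`, `integral_re_dirac_sub_re_dirac_eq_zero`):
the integrands are the divergences of the smooth 1-forms `Re⟨φ, ∇̃ψ⟩` and `Re⟨φ, γ(·)ψ⟩`
(`GaugeTheory/SpincStructureCovDerivPairingForm`, `GaugeTheory/SpincStructureDiracAdjoint`), to which
the divergence theorem `SymplecticDivergenceIntegral` applies.  Also recorded: the divergence of a
smooth 1-form is a smooth function on `N` (`contMDiff_divergence`, `GaugeTheory/SpincStructureDivergence`),
and the consequence of the two adjointness identities and Morgan's Prop. 5.1.5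
(`∂_A∂_A = ∇_A^*∇_A + κ/4 + ½F_A·`): **the integrated Weitzenböck formula**
`∫_N (|∇_Aψ|² + Re⟨ψ, (κ/4)ψ + ½iF_A·ψ⟩ - |∂_Aψ|²)(s ∧ s) = 0` (`integral_weitzenbock_eq_zero`).

PROVED, 0 named facts.

## References

* C. H. Taubes, *The Seiberg–Witten invariants and symplectic forms*, Math. Res. Lett. 1 (1994)
  809–822, §2 (proof of Lemma 3), §3 (21)–(22). [Taubes1994]
* J. W. Morgan, *The Seiberg–Witten Equations and Applications to the Topology of Smooth
  Four-Manifolds* (1996), Cor. 5.2.2 (proof). [MorganSWBook1996]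
-/

noncomputable section

open scoped Manifold ContDiff ComplexConjugate Matrix Topology
open Set Function Filter Complex Literature.Geometry.Kaehler Literature.Geometry.GaugeTheory Literature.Topology.FourManifolds
open Literature.Geometry.Lorentzian (PseudoRiemannianMetric)
open Literature.Geometry.Manifold Literature.Geometry.Manifold.DeRhamSignFour Literature.NumberTheory.Transcendental

namespace Literature.Geometry.Symplectic

namespace AlmostComplexStructure.IsCompatibleWith

variable {N : Type} [TopologicalSpace N] [ChartedSpace (EuclideanSpace ℝ (Fin 4)) N] [IsManifold (𝓡 4) ∞ N]
  {J : AlmostComplexStructure (𝓡 4) ∞ N} {s : MForm (𝓡 4) N ℝ 2}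
  (h : J.IsCompatibleWith s) (hs : IsSmoothForm s)
  (hnd : ∀ x (v : TangentSpace (𝓡 4) x), v ≠ 0 → ∃ w : TangentSpace (𝓡 4) x, s x ![v, w] ≠ 0)
  [(h.metric hs).HasLeviCivita]

/-- **The divergence of a smooth real 1-form is a smooth function on `N`** (chart independence and
local smoothness, `SpincStructure.contMDiff_sum_covDerivForm_frame_indexAt`). [cite: WarnerGTM94, 6.1] -/
theorem contMDiff_divergence {θ : RealOneForm N} (hθ : IsSmoothForm θ.toMForm) :
    ContMDiff (𝓡 4) 𝓘(ℝ, ℝ) ∞ (h.divergence hs hnd θ) :=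
  (h.canonicalSpincStructure hs hnd).contMDiff_sum_covDerivForm_frame_indexAt hθ

/-- **`∫_N (Σ_k Re⟨∇̃_{e_k}φ, ∇̃_{e_k}ψ⟩ - Re⟨φ, ∇_A^*∇_Aψ⟩)(s ∧ s) = 0`** — the formal
self-adjointness `∫⟨φ, ∇_A^*∇_Aψ⟩ = ∫⟨∇_Aφ, ∇_Aψ⟩` of the connection Laplacian of `𝔰_J` on the closed
symplectic `4`-manifold, for any unitary connection `A` on `det P̃` and smooth spinor fields `ψ`, `φ`
(each term read in the unitary frame of the chart at the point): the integrand is `div Re⟨φ, ∇̃ψ⟩`.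
[cite: Taubes1994, §3 (21) (p. 817)] [cite: MorganSWBook1996, Cor. 5.2.2 (proof)] -/
theorem integral_re_covDeriv_pairing_sub_re_laplacian_eq_zero [T2Space N] [CompactSpace N] (hcl : IsClosedForm s)
    (A : (h.canonicalSpincStructure hs hnd).detLineBundle.Connection) {ψ φ : SpinorField (h.canonicalSpincStructure hs hnd)}
    (hψ : ψ.IsSmooth) (hφ : φ.IsSmooth) :
    MForm.integral (rayFamily (wedge_self_castDeg_apply_ne_zero s hnd))
      ((fun x ↦ ∑ k, (star (SpincStructure.covDeriv A φ ((h.canonicalSpincStructure hs hnd).indexAt x) x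
            ((h.canonicalSpincStructure hs hnd).frame ((h.canonicalSpincStructure hs hnd).indexAt x) k x)) ⬝ᵥ
          SpincStructure.covDeriv A ψ ((h.canonicalSpincStructure hs hnd).indexAt x) x
            ((h.canonicalSpincStructure hs hnd).frame ((h.canonicalSpincStructure hs hnd).indexAt x) k x)).re -
        (star (φ.toFun ((h.canonicalSpincStructure hs hnd).indexAt x) x) ⬝ᵥ
          (h.canonicalSpincStructure hs hnd).localLaplacian A ((h.canonicalSpincStructure hs hnd).indexAt x)
            (ψ.toFun ((h.canonicalSpincStructure hs hnd).indexAt x)) x).re) •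
        (s.wedge s).castDeg two_add_two_eq_four) = 0 := by
  have hint := h.integral_divergence_smul_wedge_self_eq_zero hs hnd hcl
    (θ := (h.canonicalSpincStructure hs hnd).covDerivPairingForm A ψ φ)
    fun x ↦ (h.canonicalSpincStructure hs hnd).smoothAt_covDerivPairingForm A hψ hφ x
  have heq : h.divergence hs hnd ((h.canonicalSpincStructure hs hnd).covDerivPairingForm A ψ φ) = fun x ↦
      ∑ k, (star (SpincStructure.covDeriv A φ ((h.canonicalSpincStructure hs hnd).indexAt x) x
            ((h.canonicalSpincStructure hs hnd).frame ((h.canonicalSpincStructure hs hnd).indexAt x) k x)) ⬝ᵥ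
          SpincStructure.covDeriv A ψ ((h.canonicalSpincStructure hs hnd).indexAt x) x
            ((h.canonicalSpincStructure hs hnd).frame ((h.canonicalSpincStructure hs hnd).indexAt x) k x)).re -
        (star (φ.toFun ((h.canonicalSpincStructure hs hnd).indexAt x) x) ⬝ᵥ
          (h.canonicalSpincStructure hs hnd).localLaplacian A ((h.canonicalSpincStructure hs hnd).indexAt x)
            (ψ.toFun ((h.canonicalSpincStructure hs hnd).indexAt x)) x).re := by
    funext x
    exact (h.canonicalSpincStructure hs hnd).sum_covDerivForm_covDerivPairingForm_eq A hψ hφ _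
      ((h.canonicalSpincStructure hs hnd).mem_baseSet_indexAt x)
  rw [heq] at hint
  exact hint

/-- The divergence of `Re⟨φ, ∇̃ψ⟩` is `Σ_k Re⟨∇̃_{e_k}φ, ∇̃_{e_k}ψ⟩ - Re⟨φ, ∇_A^*∇_Aψ⟩` (chart at each point).
[cite: MorganSWBook1996, Cor. 5.2.2 (proof)] -/
theorem divergence_covDerivPairingForm_eq (A : (h.canonicalSpincStructure hs hnd).detLineBundle.Connection)
    {ψ φ : SpinorField (h.canonicalSpincStructure hs hnd)} (hψ : ψ.IsSmooth) (hφ : φ.IsSmooth) :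
    h.divergence hs hnd ((h.canonicalSpincStructure hs hnd).covDerivPairingForm A ψ φ) = fun x ↦
      ∑ k, (star (SpincStructure.covDeriv A φ ((h.canonicalSpincStructure hs hnd).indexAt x) x
            ((h.canonicalSpincStructure hs hnd).frame ((h.canonicalSpincStructure hs hnd).indexAt x) k x)) ⬝ᵥ
          SpincStructure.covDeriv A ψ ((h.canonicalSpincStructure hs hnd).indexAt x) x
            ((h.canonicalSpincStructure hs hnd).frame ((h.canonicalSpincStructure hs hnd).indexAt x) k x)).re -
        (star (φ.toFun ((h.canonicalSpincStructure hs hnd).indexAt x) x) ⬝ᵥ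
          (h.canonicalSpincStructure hs hnd).localLaplacian A ((h.canonicalSpincStructure hs hnd).indexAt x)
            (ψ.toFun ((h.canonicalSpincStructure hs hnd).indexAt x)) x).re :=
  funext fun x ↦ (h.canonicalSpincStructure hs hnd).sum_covDerivForm_covDerivPairingForm_eq A hψ hφ _
    ((h.canonicalSpincStructure hs hnd).mem_baseSet_indexAt x)

/-- The divergence of `Re⟨φ, γ(·)ψ⟩` is `Re⟨φ, ∂_Aψ⟩ - Re⟨∂_Aφ, ψ⟩` (chart at each point). [cite: MorganSWBook1996, §3.3 (3.3)] -/
theorem divergence_cliffordPairingForm_eq (A : (h.canonicalSpincStructure hs hnd).detLineBundle.Connection)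
    {ψ φ : SpinorField (h.canonicalSpincStructure hs hnd)} (hψ : ψ.IsSmooth) (hφ : φ.IsSmooth) :
    h.divergence hs hnd ((h.canonicalSpincStructure hs hnd).cliffordPairingForm ψ φ) = fun x ↦
      (star (φ.toFun ((h.canonicalSpincStructure hs hnd).indexAt x) x) ⬝ᵥ
          SpincStructure.dirac A ψ ((h.canonicalSpincStructure hs hnd).indexAt x) x).re -
        (star (SpincStructure.dirac A φ ((h.canonicalSpincStructure hs hnd).indexAt x) x) ⬝ᵥ
          ψ.toFun ((h.canonicalSpincStructure hs hnd).indexAt x) x).re :=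
  funext fun x ↦ (h.canonicalSpincStructure hs hnd).sum_covDerivForm_cliffordPairingForm_eq A hψ hφ _
    ((h.canonicalSpincStructure hs hnd).mem_baseSet_indexAt x)

/-- **`∫_N (Re⟨φ, D_Aψ⟩ - Re⟨D_Aφ, ψ⟩)(s ∧ s) = 0`** — the formal self-adjointness of the `Spin^c`
Dirac operator `D_A = Σ_k γ_k∇̃_{e_k}` of `𝔰_J` on the closed symplectic `4`-manifold, for any unitary
connection `A` on `det P̃` and smooth spinor fields `ψ`, `φ` (each term read in the chart at the
point): the integrand is `div Re⟨φ, γ(·)ψ⟩`. [cite: Taubes1994, §3 (21) (p. 817)]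
[cite: MorganSWBook1996, §3.3 (3.3)] -/
theorem integral_re_dirac_sub_re_dirac_eq_zero [T2Space N] [CompactSpace N] (hcl : IsClosedForm s)
    (A : (h.canonicalSpincStructure hs hnd).detLineBundle.Connection) {ψ φ : SpinorField (h.canonicalSpincStructure hs hnd)}
    (hψ : ψ.IsSmooth) (hφ : φ.IsSmooth) :
    MForm.integral (rayFamily (wedge_self_castDeg_apply_ne_zero s hnd))
      ((fun x ↦ (star (φ.toFun ((h.canonicalSpincStructure hs hnd).indexAt x) x) ⬝ᵥ
            SpincStructure.dirac A ψ ((h.canonicalSpincStructure hs hnd).indexAt x) x).re -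
          (star (SpincStructure.dirac A φ ((h.canonicalSpincStructure hs hnd).indexAt x) x) ⬝ᵥ
            ψ.toFun ((h.canonicalSpincStructure hs hnd).indexAt x) x).re) •
        (s.wedge s).castDeg two_add_two_eq_four) = 0 := by
  have hint := h.integral_divergence_smul_wedge_self_eq_zero hs hnd hcl
    (θ := (h.canonicalSpincStructure hs hnd).cliffordPairingForm ψ φ)
    fun x ↦ (h.canonicalSpincStructure hs hnd).smoothAt_cliffordPairingForm hψ hφ x
  have heq : h.divergence hs hnd ((h.canonicalSpincStructure hs hnd).cliffordPairingForm ψ φ) = fun x ↦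
      (star (φ.toFun ((h.canonicalSpincStructure hs hnd).indexAt x) x) ⬝ᵥ
          SpincStructure.dirac A ψ ((h.canonicalSpincStructure hs hnd).indexAt x) x).re -
        (star (SpincStructure.dirac A φ ((h.canonicalSpincStructure hs hnd).indexAt x) x) ⬝ᵥ
          ψ.toFun ((h.canonicalSpincStructure hs hnd).indexAt x) x).re := by
    funext x
    exact (h.canonicalSpincStructure hs hnd).sum_covDerivForm_cliffordPairingForm_eq A hψ hφ _
      ((h.canonicalSpincStructure hs hnd).mem_baseSet_indexAt x)
  rw [heq] at hint
  exact hint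

/-- **The integrated Weitzenböck formula** on the closed symplectic `4`-manifold: for a unitary
connection `A` on `det P̃` of `𝔰_J` and a smooth spinor field `ψ`,
`∫_N (|∇_Aψ|² + Re⟨ψ, (κ/4)ψ + ½iF_A·ψ⟩ - |∂_Aψ|²)(s ∧ s) = 0`
(each term in the unitary frame of the chart at the point; `F_A·` is `cliffordTwoForm (dA_i)`, `κ` the
frame scalar curvature): Morgan's Prop. 5.1.5 `∂_A∂_Aψ = ∇_A^*∇_Aψ + (κ/4)ψ + ½F_A·ψ` paired with `ψ`
and integrated, using `∫⟨ψ, ∂_A∂_Aψ⟩ = ∫|∂_Aψ|²` and `∫⟨ψ, ∇_A^*∇_Aψ⟩ = ∫|∇_Aψ|²`.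
[cite: MorganSWBook1996, Prop. 5.1.5, Cor. 5.2.2] [cite: Taubes1994, §3 (21)–(22) (p. 817)] -/
theorem integral_weitzenbock_eq_zero [T2Space N] [CompactSpace N] (hcl : IsClosedForm s)
    (A : (h.canonicalSpincStructure hs hnd).detLineBundle.Connection) {ψ : SpinorField (h.canonicalSpincStructure hs hnd)}
    (hψ : ψ.IsSmooth) :
    MForm.integral (rayFamily (wedge_self_castDeg_apply_ne_zero s hnd))
      ((fun x ↦ ∑ k, (star (SpincStructure.covDeriv A ψ ((h.canonicalSpincStructure hs hnd).indexAt x) x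
            ((h.canonicalSpincStructure hs hnd).frame ((h.canonicalSpincStructure hs hnd).indexAt x) k x)) ⬝ᵥ
          SpincStructure.covDeriv A ψ ((h.canonicalSpincStructure hs hnd).indexAt x) x
            ((h.canonicalSpincStructure hs hnd).frame ((h.canonicalSpincStructure hs hnd).indexAt x) k x)).re
        + (star (ψ.toFun ((h.canonicalSpincStructure hs hnd).indexAt x) x) ⬝ᵥ
            (((4 : ℂ)⁻¹ * (((h.canonicalSpincStructure hs hnd).frameScalarCurv ((h.canonicalSpincStructure hs hnd).indexAt x) x : ℝ) : ℂ)) •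
                ψ.toFun ((h.canonicalSpincStructure hs hnd).indexAt x) x
              + ((2 : ℂ)⁻¹ * I) • (cliffordTwoForm ((h.canonicalSpincStructure hs hnd).extDerivMatrix
                  (A.form ((h.canonicalSpincStructure hs hnd).indexAt x)) ((h.canonicalSpincStructure hs hnd).indexAt x) x) *ᵥ
                ψ.toFun ((h.canonicalSpincStructure hs hnd).indexAt x) x))).re
        - (star (SpincStructure.dirac A ψ ((h.canonicalSpincStructure hs hnd).indexAt x) x) ⬝ᵥ
            SpincStructure.dirac A ψ ((h.canonicalSpincStructure hs hnd).indexAt x) x).re) •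
        (s.wedge s).castDeg two_add_two_eq_four) = 0 := by
  have hv : IsSmoothForm ((s.wedge s).castDeg two_add_two_eq_four) := (wedge_self_castDeg_mem_closedSmoothForms ⟨hs, hcl⟩).1
  have hne := wedge_self_castDeg_apply_ne_zero s hnd
  have hDψ := (h.canonicalSpincStructure hs hnd).isSmooth_diracField A hψ
  -- the two divergences and their smoothness
  obtain ⟨f₁, hf₁⟩ : ∃ f : N → ℝ, f = h.divergence hs hnd ((h.canonicalSpincStructure hs hnd).cliffordPairingForm ((h.canonicalSpincStructure hs hnd).diracField A hψ) ψ) := ⟨_, rfl⟩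
  obtain ⟨f₂, hf₂⟩ : ∃ f : N → ℝ, f = h.divergence hs hnd ((h.canonicalSpincStructure hs hnd).covDerivPairingForm A ψ ψ) := ⟨_, rfl⟩
  have hθ₁ : IsSmoothForm ((h.canonicalSpincStructure hs hnd).cliffordPairingForm ((h.canonicalSpincStructure hs hnd).diracField A hψ) ψ).toMForm :=
    fun x ↦ (h.canonicalSpincStructure hs hnd).smoothAt_cliffordPairingForm hDψ hψ x
  have hθ₂ : IsSmoothForm ((h.canonicalSpincStructure hs hnd).covDerivPairingForm A ψ ψ).toMForm :=
    fun x ↦ (h.canonicalSpincStructure hs hnd).smoothAt_covDerivPairingForm A hψ hψ x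
  have hs₁ : ContMDiff (𝓡 4) 𝓘(ℝ, ℝ) ∞ f₁ := hf₁ ▸ h.contMDiff_divergence hs hnd hθ₁
  have hs₂ : ContMDiff (𝓡 4) 𝓘(ℝ, ℝ) ∞ f₂ := hf₂ ▸ h.contMDiff_divergence hs hnd hθ₂
  have hI₁ : MForm.integral (rayFamily hne) (f₁ • (s.wedge s).castDeg two_add_two_eq_four) = 0 :=
    hf₁ ▸ h.integral_divergence_smul_wedge_self_eq_zero hs hnd hcl hθ₁
  have hI₂ : MForm.integral (rayFamily hne) (f₂ • (s.wedge s).castDeg two_add_two_eq_four) = 0 :=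
    hf₂ ▸ h.integral_divergence_smul_wedge_self_eq_zero hs hnd hcl hθ₂
  have hsum : MForm.integral (rayFamily hne) ((fun x ↦ f₁ x + f₂ x) • (s.wedge s).castDeg two_add_two_eq_four) = 0 := by
    have heq : ((fun x ↦ f₁ x + f₂ x) • (s.wedge s).castDeg two_add_two_eq_four : MForm (𝓡 4) N ℝ 4) =
        f₁ • (s.wedge s).castDeg two_add_two_eq_four + f₂ • (s.wedge s).castDeg two_add_two_eq_four := by
      funext x
      ext w
      simp [add_mul]
    rw [heq, MForm.integral_add_holds _ (isContinuousOrientation_rayFamily hv hne) (isSmoothForm_fun_smul hv hs₁)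
      (isSmoothForm_fun_smul hv hs₂), hI₁, hI₂, add_zero]
  -- the pointwise Weitzenböck formula
  have hpt : ∀ x, f₁ x + f₂ x =
      ∑ k, (star (SpincStructure.covDeriv A ψ ((h.canonicalSpincStructure hs hnd).indexAt x) x ((h.canonicalSpincStructure hs hnd).frame ((h.canonicalSpincStructure hs hnd).indexAt x) k x)) ⬝ᵥ
          SpincStructure.covDeriv A ψ ((h.canonicalSpincStructure hs hnd).indexAt x) x ((h.canonicalSpincStructure hs hnd).frame ((h.canonicalSpincStructure hs hnd).indexAt x) k x)).re
        + (star (ψ.toFun ((h.canonicalSpincStructure hs hnd).indexAt x) x) ⬝ᵥ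
            (((4 : ℂ)⁻¹ * (((h.canonicalSpincStructure hs hnd).frameScalarCurv ((h.canonicalSpincStructure hs hnd).indexAt x) x : ℝ) : ℂ)) • ψ.toFun ((h.canonicalSpincStructure hs hnd).indexAt x) x
              + ((2 : ℂ)⁻¹ * I) • (cliffordTwoForm ((h.canonicalSpincStructure hs hnd).extDerivMatrix (A.form ((h.canonicalSpincStructure hs hnd).indexAt x)) ((h.canonicalSpincStructure hs hnd).indexAt x) x) *ᵥ
                ψ.toFun ((h.canonicalSpincStructure hs hnd).indexAt x) x))).re
        - (star (SpincStructure.dirac A ψ ((h.canonicalSpincStructure hs hnd).indexAt x) x) ⬝ᵥ SpincStructure.dirac A ψ ((h.canonicalSpincStructure hs hnd).indexAt x) x).re := by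
    intro x
    have hi := (h.canonicalSpincStructure hs hnd).mem_baseSet_indexAt x
    have hW := (h.canonicalSpincStructure hs hnd).localDirac_dirac A hψ hi
    have hdd : SpincStructure.dirac A ((h.canonicalSpincStructure hs hnd).diracField A hψ) ((h.canonicalSpincStructure hs hnd).indexAt x) x =
        (h.canonicalSpincStructure hs hnd).localDirac A ((h.canonicalSpincStructure hs hnd).indexAt x) (fun y ↦ SpincStructure.dirac A ψ ((h.canonicalSpincStructure hs hnd).indexAt x) y) x := by
      rw [(h.canonicalSpincStructure hs hnd).dirac_eq_localDirac]
      rfl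
    have h1 : f₁ x = (star (ψ.toFun ((h.canonicalSpincStructure hs hnd).indexAt x) x) ⬝ᵥ SpincStructure.dirac A ((h.canonicalSpincStructure hs hnd).diracField A hψ) ((h.canonicalSpincStructure hs hnd).indexAt x) x).re -
        (star (SpincStructure.dirac A ψ ((h.canonicalSpincStructure hs hnd).indexAt x) x) ⬝ᵥ ((h.canonicalSpincStructure hs hnd).diracField A hψ).toFun ((h.canonicalSpincStructure hs hnd).indexAt x) x).re := by
      rw [hf₁, h.divergence_cliffordPairingForm_eq hs hnd A hDψ hψ]
    have h2 : f₂ x = ∑ k, (star (SpincStructure.covDeriv A ψ ((h.canonicalSpincStructure hs hnd).indexAt x) x ((h.canonicalSpincStructure hs hnd).frame ((h.canonicalSpincStructure hs hnd).indexAt x) k x)) ⬝ᵥ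
          SpincStructure.covDeriv A ψ ((h.canonicalSpincStructure hs hnd).indexAt x) x ((h.canonicalSpincStructure hs hnd).frame ((h.canonicalSpincStructure hs hnd).indexAt x) k x)).re -
        (star (ψ.toFun ((h.canonicalSpincStructure hs hnd).indexAt x) x) ⬝ᵥ (h.canonicalSpincStructure hs hnd).localLaplacian A ((h.canonicalSpincStructure hs hnd).indexAt x) (ψ.toFun ((h.canonicalSpincStructure hs hnd).indexAt x)) x).re := by
      rw [hf₂, h.divergence_covDerivPairingForm_eq hs hnd A hψ hψ]
    rw [h1, h2, SpincStructure.diracField_toFun, hdd, hW]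
    simp only [dotProduct_add, Complex.add_re]
    ring
  have hfun : (fun x ↦ f₁ x + f₂ x) = _ := funext hpt
  rw [hfun] at hsum
  exact hsum

end AlmostComplexStructure.IsCompatibleWith

end Literature.Geometry.Symplectic

end
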